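import Literature.Computability.Complexity.ExtMonotoneCircuits
import Literature.Computability.Complexity.MonotoneSwitching
import Literature.Computability.Complexity.CliqueTestGraphs
import Literature.Computability.Complexity.CircuitComposition

/-!
# Definitions of line `width-threshold-certificate-sparsity` for the crux `CliqueExtLowerBound`
(stmt-PneNP-10682, route PneNP/ConvexRankGates): the referee pair and the event currency

Objects the line posits (no mathematics is claimed here; every item is a plain definition):

* §1 the REFEREE PAIR at `δ = 1/4`: clique size `kk m = ⌈m^{1/4}⌉₊`, the POSITIVES
  `posFam m` = bare `k`-cliques (`posGraphs`, Jukna 2012 §9.1), the NEGATIVES `negFam m` =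
  complements of the `tt m`-edge graphs, `tt m = #E(K_m) / ⌊m^{1/8}⌋₊` (a negative misses a
  `≈ m^{-1/8}` fraction of the edges), the width threshold `TT m = ⌊m^{1/16}⌋₊` and the per-gate
  error budget `eps m c = 1/(8 m^{c+1})`;
* §2 the EVENT CURRENCY of the two-sided approximation (Jukna 2012 §9.4, Thm 9.17, errors charged to
  events on the referee families instead of global correcting families): `IsLocal`, the children's
  values `dval`/`cval`, and the three per-gate properties `Sandwichable` (what one induction step
  needs), `Replaceable` (replaceable by a small `{∧₂,∨₂,0,1}`-circuit on the two push-forwards) and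
  `InlineFree` (a small `{∧₂,∨₂,0,1}`-circuit fed with local pairs has an output pair);
* §3 the CURRENCY LEMMAS (proved): error monotonicity, `Replaceable + InlineFree ⇒ Sandwichable`
  (errors add), `∧₂/∨₂` replace themselves, and the case split of the extended basis
  (`gates_sandwichable`: every gate of `B_{m^c}` is sandwichable from the per-class statements).

The registered stubs of the line are these properties UNFOLDED (each stub file is self-contained);
this file names them for the composition (`…WidthThresholdNarrow.lean`) and for readers.

References: S. Jukna, *Boolean Function Complexity* (2012), §9.1 (test graphs), §9.3–9.4
(Lemma 9.15, Thm 9.17) [Jukna2012].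
-/

set_option linter.dupNamespace false

open Literature.Computability.Complexity Filter Finset

noncomputable section

namespace Summit.PneNP.PneNP.Theorems.CliqueExtLowerBound.WidthThreshold

/-! ## §1 Parameters and the referee pair (`δ₀ = 1/4`) -/

/-- The edge slots of `K_m` (the input variables of the crux). [folklore] -/
abbrev EV (m : ℕ) : Type := (⊤ : SimpleGraph (Fin m)).edgeSet

/-- Clique size `k(m) = ⌈m^{1/4}⌉₊` (the crux's `⌈m^δ⌉₊` at `δ = 1/4`). [folklore] -/
def kk (m : ℕ) : ℕ := ⌈(m : ℝ) ^ (1 / 4 : ℝ)⌉₊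

/-- Number of edge slots `#E(K_m)`. [folklore] -/
def nN (m : ℕ) : ℕ := Fintype.card (EV m)

/-- Density denominator `D(m) = ⌊m^{1/8}⌋₊`: a negative misses `#E / D` edges (`γ ≈ m^{-1/8}`).
[folklore] -/
def dD (m : ℕ) : ℕ := ⌊(m : ℝ) ^ (1 / 8 : ℝ)⌋₊

/-- Number of missing edges of a negative, `t(m) = #E(K_m) / ⌊m^{1/8}⌋₊`. [folklore] -/
def tt (m : ℕ) : ℕ := nN m / dD m

/-- The width threshold `T(m) = ⌊m^{1/16}⌋₊ = k^{1/4}` below which PERM/GRANK gates are free.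
[folklore] -/
def TT (m : ℕ) : ℕ := ⌊(m : ℝ) ^ (1 / 16 : ℝ)⌋₊

/-- Per-gate, per-side error budget `ε(m,c) = 1 / (8 m^{c+1})` (a circuit has `≤ m^c` gates).
[folklore] -/
def eps (m c : ℕ) : ℝ := 1 / (8 * (m : ℝ) ^ (c + 1))

/-- POSITIVES: the bare `k`-cliques (clique vectors of the `k`-subsets; Jukna 2012 §9.1).
[cite: Jukna2012, §9.1] -/
def posFam (m : ℕ) : Finset (EV m → Bool) := posGraphs m (kk m)

/-- NEGATIVES: complements of the `t(m)`-edge graphs (uniform model `G(m, #E - t)`): for each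
`t`-subset `M` of the edge slots, the vector "every edge on except those of `M`". [folklore] -/
def negFam (m : ℕ) : Finset (EV m → Bool) :=
  (powersetCard (tt m) (univ : Finset (EV m))).image fun M => fun e => decide (e ∉ M)

/-! ## §2 The event currency: local pairs, sandwichable and replaceable gates -/

section Currency

variable {ι : Type} [DecidableEq ι]

/-- A monotone DNF/CNF family (set of monomials / clauses) is `w`-local if every member has fewer
than `w` variables (the `(w-1)`-DNF / `(w-1)`-CNF convention of `MonotoneSwitching`). [folklore] -/
def IsLocal (w : ℕ) (F : Finset (Finset ι)) : Prop := ∀ R ∈ F, #R ≤ w - 1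

open Classical in
/-- Values of a tuple of DNFs at the input `x` (what a gate sees on the POSITIVE side). [folklore] -/
def dval {n : ℕ} (d : Fin n → Finset (Finset ι)) (x : ι → Bool) : Fin n → Bool :=
  fun j => decide (EvalDNF (d j) x)

open Classical in
/-- Values of a tuple of CNFs at the input `x` (what a gate sees on the NEGATIVE side). [folklore] -/
def cval {n : ℕ} (c : Fin n → Finset (Finset ι)) (x : ι → Bool) : Fin n → Bool :=
  fun j => decide (EvalCNF (c j) x)

open Classical in
/-- `φ` is `(r,s)`-SANDWICHABLE on the referee pair `(P, N)` with error `ε`, for children drawn from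
at most `A` distinct local pairs: for all tuples of `r`-local DNFs `d ≤` `s`-local CNFs `c` (one
pair per input position) there is an `r`-local DNF `dnf ≤` an `s`-local CNF `cnf` such that
`φ(d(x)) ≤ dnf(x)` for all but `ε·#P` positives `x ∈ P` and `cnf(x) ≤ φ(c(x))` for all but `ε·#N`
negatives `x ∈ N` — exactly what one induction step of the two-sided approximation needs
(Jukna 2012, proof of Thm 9.17, with errors charged to events instead of correcting families).
[cite: Jukna2012, Thm. 9.17] -/
def Sandwichable (r s A : ℕ) (P N : Finset (ι → Bool)) (ε : ℝ) (φ : GateFn) : Prop :=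
  ∀ (d c : Fin φ.1 → Finset (Finset ι)),
    #(univ.image fun j => (d j, c j)) ≤ A →
    (∀ j, IsLocal r (d j)) → (∀ j, IsLocal s (c j)) →
    (∀ j x, EvalDNF (d j) x → EvalCNF (c j) x) →
    ∃ dnf cnf : Finset (Finset ι), IsLocal r dnf ∧ IsLocal s cnf ∧
      (∀ x, EvalDNF dnf x → EvalCNF cnf x) ∧
      (#(P.filter fun x => φ.2 (dval d x) = true ∧ ¬ EvalDNF dnf x) : ℝ) ≤ ε * #P ∧
      (#(N.filter fun x => EvalCNF cnf x ∧ φ.2 (cval c x) = false) : ℝ) ≤ ε * #N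

open Classical in
/-- `φ` is REPLACEABLE by monotone complexity `a` on the referee pair: for all tuples of local
children as above there is a circuit `Ψ` over `{∧₂, ∨₂, 0, 1}` with `≤ a` gates on the input
positions of `φ` such that `φ(d(x)) ≤ Ψ(d(x))` for all but `ε·#P` positives and
`Ψ(c(x)) ≤ φ(c(x))` for all but `ε·#N` negatives (one-sided special cases: an AND of few sound
rejection certificates, an OR of few short minterms, a constant for a gate blind on one family).
[folklore] -/
def Replaceable (r s A a : ℕ) (P N : Finset (ι → Bool)) (ε : ℝ) (φ : GateFn) : Prop :=
  ∀ (d c : Fin φ.1 → Finset (Finset ι)),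
    #(univ.image fun j => (d j, c j)) ≤ A →
    (∀ j, IsLocal r (d j)) → (∀ j, IsLocal s (c j)) →
    (∀ j x, EvalDNF (d j) x → EvalCNF (c j) x) →
    ∃ Ψ : Circuit (Fin φ.1), Ψ.IsOver monotoneBasis01 ∧ Ψ.size ≤ a ∧
      (#(P.filter fun x => φ.2 (dval d x) = true ∧ Ψ.eval (dval d x) = false) : ℝ) ≤ ε * #P ∧
      (#(N.filter fun x => Ψ.eval (cval c x) = true ∧ φ.2 (cval c x) = false) : ℝ) ≤ ε * #N

open Classical in
/-- INLINE FREENESS at monotone complexity `a`: every `{∧₂,∨₂,0,1}`-circuit with `≤ a` gates, fed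
with local pairs `d ≤ c`, has an output pair `dnf ≤ cnf` with `Ψ(d(x)) ≤ dnf(x)` off `ε·#P`
positives and `cnf(x) ≤ Ψ(c(x))` off `ε·#N` negatives (Jukna's Theorem 9.17 run through `Ψ` with
the children's pairs as leaves). [cite: Jukna2012, Thm. 9.17] -/
def InlineFree (r s a : ℕ) (P N : Finset (ι → Bool)) (ε : ℝ) : Prop :=
  ∀ (n : ℕ) (Ψ : Circuit (Fin n)), Ψ.IsOver monotoneBasis01 → Ψ.size ≤ a →
    ∀ (d c : Fin n → Finset (Finset ι)),
      (∀ j, IsLocal r (d j)) → (∀ j, IsLocal s (c j)) →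
      (∀ j x, EvalDNF (d j) x → EvalCNF (c j) x) →
      ∃ dnf cnf : Finset (Finset ι), IsLocal r dnf ∧ IsLocal s cnf ∧
        (∀ x, EvalDNF dnf x → EvalCNF cnf x) ∧
        (#(P.filter fun x => Ψ.eval (dval d x) = true ∧ ¬ EvalDNF dnf x) : ℝ) ≤ ε * #P ∧
        (#(N.filter fun x => EvalCNF cnf x ∧ Ψ.eval (cval c x) = false) : ℝ) ≤ ε * #N

end Currency

/-! ## §3 Currency lemmas (proved) -/


section CompositionLemmas

variable {ι : Type} [DecidableEq ι]

/-- Sandwichability is monotone in the error budget. -/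
theorem Sandwichable.of_le {r s A : ℕ} {P N : Finset (ι → Bool)} {ε ε' : ℝ} {φ : GateFn}
    (h : Sandwichable r s A P N ε φ) (hle : ε ≤ ε') : Sandwichable r s A P N ε' φ := by
  intro d c hA hd hc hdc
  obtain ⟨dnf, cnf, h1, h2, h3, h4, h5⟩ := h d c hA hd hc hdc
  exact ⟨dnf, cnf, h1, h2, h3, h4.trans (mul_le_mul_of_nonneg_right hle (Nat.cast_nonneg _)),
    h5.trans (mul_le_mul_of_nonneg_right hle (Nat.cast_nonneg _))⟩

/-- Card of a filter bounded by two filters covering it (instance-agnostic bookkeeping). -/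
theorem card_filter_le_add {α : Type} (S : Finset α) (p q₁ q₂ : α → Prop) [DecidablePred p]
    [DecidablePred q₁] [DecidablePred q₂] (h : ∀ x ∈ S, p x → q₁ x ∨ q₂ x) :
    (#(S.filter p) : ℝ) ≤ #(S.filter q₁) + #(S.filter q₂) := by
  classical
  have : #(S.filter p) ≤ #(S.filter q₁ ∪ S.filter q₂) := by
    refine card_le_card fun x hx => ?_
    rw [mem_filter] at hx
    rw [mem_union, mem_filter, mem_filter]
    rcases h x hx.1 hx.2 with h1 | h1
    · exact Or.inl ⟨hx.1, h1⟩
    · exact Or.inr ⟨hx.1, h1⟩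
  exact_mod_cast this.trans (card_union_le _ _)

/-- REPLACEABLE + INLINE-FREE ⇒ SANDWICHABLE (errors add): the line's reduction of a wide gate to its
low-complexity replacement. -/
theorem sandwichable_of_replaceable {r s A a : ℕ} {P N : Finset (ι → Bool)} {ε ε' : ℝ} {φ : GateFn}
    (hR : Replaceable r s A a P N ε φ) (hI : InlineFree r s a P N ε') :
    Sandwichable r s A P N (ε + ε') φ := by
  classical
  intro d c hA hd hc hdc
  obtain ⟨Ψ, hΨ, hsz, hP, hN⟩ := hR d c hA hd hc hdc
  obtain ⟨dnf, cnf, h1, h2, h3, h4, h5⟩ := hI φ.1 Ψ hΨ hsz d c hd hc hdc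
  refine ⟨dnf, cnf, h1, h2, h3, ?_, ?_⟩
  · calc (#(P.filter fun x => φ.2 (dval d x) = true ∧ ¬ EvalDNF dnf x) : ℝ)
        ≤ #(P.filter fun x => φ.2 (dval d x) = true ∧ Ψ.eval (dval d x) = false) +
            #(P.filter fun x => Ψ.eval (dval d x) = true ∧ ¬ EvalDNF dnf x) := by
          refine card_filter_le_add P _ _ _ fun x _ hx => ?_
          cases hΨx : Ψ.eval (dval d x)
          · exact Or.inl ⟨hx.1, rfl⟩
          · exact Or.inr ⟨rfl, hx.2⟩
      _ ≤ ε * #P + ε' * #P := add_le_add hP h4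
      _ = (ε + ε') * #P := by ring
  · calc (#(N.filter fun x => EvalCNF cnf x ∧ φ.2 (cval c x) = false) : ℝ)
        ≤ #(N.filter fun x => Ψ.eval (cval c x) = true ∧ φ.2 (cval c x) = false) +
            #(N.filter fun x => EvalCNF cnf x ∧ Ψ.eval (cval c x) = false) := by
          refine card_filter_le_add N _ _ _ fun x _ hx => ?_
          cases hΨx : Ψ.eval (cval c x)
          · exact Or.inr ⟨hx.1, rfl⟩
          · exact Or.inl ⟨rfl, hx.2⟩
      _ ≤ ε * #N + ε' * #N := add_le_add hN h5
      _ = (ε + ε') * #N := by ring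

end CompositionLemmas


/-- `∧₂` and `∨₂` are replaceable by themselves (monotone complexity `1`, no error). -/
theorem replaceable_of_mem_monotoneBasis {ι : Type} [DecidableEq ι] {r s A a : ℕ} (ha : 1 ≤ a)
    {P N : Finset (ι → Bool)} {ε : ℝ} (hε : 0 ≤ ε) {φ : GateFn} (hφ : φ ∈ monotoneBasis) :
    Replaceable r s A a P N ε φ := by
  classical
  intro d c _ _ _ _
  obtain ⟨Ψ, hΨ, hsz, he⟩ :=
    (CktSize.gate (B := monotoneBasis01) φ (monotoneBasis_subset_monotoneBasis01 hφ) id).toCircuit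
  refine ⟨Ψ, hΨ, hsz.trans ha, ?_, ?_⟩
  · have h0 : P.filter (fun x => φ.2 (dval d x) = true ∧ Ψ.eval (dval d x) = false) = ∅ := by
      refine Finset.filter_eq_empty_iff.2 fun x _ h => ?_
      rw [he] at h
      exact Bool.false_ne_true (h.2.symm.trans h.1)
    rw [h0, card_empty, Nat.cast_zero]
    positivity
  · have h0 : N.filter (fun x => Ψ.eval (cval c x) = true ∧ φ.2 (cval c x) = false) = ∅ := by
      refine Finset.filter_eq_empty_iff.2 fun x _ h => ?_
      rw [he] at h
      exact Bool.false_ne_true (h.2.symm.trans h.1)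
    rw [h0, card_empty, Nat.cast_zero]
    positivity

/-- EVERY GATE OF `B_{m^c}` IS SANDWICHABLE, from the four per-class stubs at one `m` (case split of
`mem_extGate_iff`; `∧₂, ∨₂ ∈ CONV₁ ⊆ CONV_{m^c}`; narrow vs wide PERM/GRANK by the threshold `T(m)`). -/
theorem gates_sandwichable {m c r s a₁ a₂ : ℕ} (hm : 1 ≤ m)
    (hI₁ : InlineFree r s (m ^ a₁) (posFam m) (negFam m) (eps m c))
    (hI₂ : InlineFree r s (m ^ a₂) (posFam m) (negFam m) (eps m c))
    (hN : ∀ φ : GateFn, (IsPermGate (TT m) φ ∨ IsGRankGate (TT m) φ) →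
      Sandwichable r s (m ^ (c + 3)) (posFam m) (negFam m) (eps m c) φ)
    (hAlg : ∀ φ : GateFn, (IsPermGate (m ^ c) φ ∨ IsGRankGate (m ^ c) φ) →
      ¬ (IsPermGate (TT m) φ ∨ IsGRankGate (TT m) φ) →
      Replaceable r s (m ^ (c + 3)) (m ^ a₂) (posFam m) (negFam m) (eps m c) φ)
    (hConv : ∀ φ : GateFn, IsConvGate (m ^ c) φ →
      Replaceable r s (m ^ (c + 3)) (m ^ a₁) (posFam m) (negFam m) (eps m c) φ)
    (φ : GateFn) (hφ : φ ∈ extGate (m ^ c)) :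
    Sandwichable r s (m ^ (c + 3)) (posFam m) (negFam m) (2 * eps m c) φ := by
  have h1c : 1 ≤ m ^ c := Nat.one_le_pow _ _ hm
  have hε0 : 0 ≤ eps m c := by unfold eps; positivity
  have htwo : eps m c + eps m c = 2 * eps m c := by ring
  have conv_case : IsConvGate (m ^ c) φ →
      Sandwichable r s (m ^ (c + 3)) (posFam m) (negFam m) (2 * eps m c) φ := fun h =>
    htwo ▸ sandwichable_of_replaceable (hConv φ h) hI₁
  have alg_case : (IsPermGate (m ^ c) φ ∨ IsGRankGate (m ^ c) φ) →
      Sandwichable r s (m ^ (c + 3)) (posFam m) (negFam m) (2 * eps m c) φ := fun h => by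
    by_cases hn : IsPermGate (TT m) φ ∨ IsGRankGate (TT m) φ
    · exact (hN φ hn).of_le (by linarith)
    · exact htwo ▸ sandwichable_of_replaceable (hAlg φ h hn) hI₂
  rw [mem_extGate_iff] at hφ
  rcases hφ with rfl | rfl | h | h | h
  · exact conv_case ((and_isConvGate 2).mono h1c)
  · exact conv_case ((or_isConvGate 2).mono h1c)
  · exact conv_case h
  · exact alg_case (Or.inl h)
  · exact alg_case (Or.inr h)

/-- REGISTERED SUB-GOAL of the line (binder-free form of `sandwichable_of_replaceable`): a gate
replaceable by monotone complexity `a`, at which inline expansion is free, is sandwichable; errors add.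
[folklore] -/
theorem widthThreshold_sandwichable_of_replaceable : ∀ (ι : Type) [DecidableEq ι] (r s A a : ℕ)
    (P N : Finset (ι → Bool)) (ε ε' : ℝ) (φ : GateFn),
    Replaceable r s A a P N ε φ → InlineFree r s a P N ε' → Sandwichable r s A P N (ε + ε') φ :=
  fun _ _ _ _ _ _ _ _ _ _ _ hR hI => sandwichable_of_replaceable hR hI

end Summit.PneNP.PneNP.Theorems.CliqueExtLowerBound.WidthThreshold

end
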